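import Literature.NumberTheory.NumberFields.CMFieldHasseNorm
import Literature.NumberTheory.QuadraticForms.HilbertSymbolAtUnramifiedPlace
import Literature.NumberTheory.Automorphic.QuaternionRamificationParityHolds
import HarnessLib

/-!
# Totally positive units of `K⁺` are norms from a CM field `K` ramified at no, or at one, finite prime
# (Horie, *Acta Arith.* 67 (1994), proof of Lemma 1 (ii))

Topic `NumberTheory/NumberFields`; namespace `Literature.NumberTheory.NumberFields`.  Theorem-only file (no
definition, no named fact, no `sorry`), unconditional.

> Horie, §1, proof of Lemma 1: "Next assume `t_K = 1`.  The product formula for the Hasse norm residue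
> symbol then shows that every element of `E⁺_{K⁺}` is a norm residue for `K/K⁺` modulo the conductor of
> `K/K⁺`, whence, by the Hasse norm theorem for `K/K⁺`, `E⁺_{K⁺} ⊆ N_{K/K⁺}(K^×)`, namely
> `E⁺_{K⁺} = N_{K/K⁺}(K^×) ∩ E_{K⁺}`. […] In the case `t_K = 0`, the assertion (ii) is an immediate
> consequence of (1.1) and the Hasse norm theorem for `K/K⁺`."

Here `K` is a CM field (Mathlib `IsCMField`), `K⁺ = maximalRealSubfield K`, `t_K` the number of finite primes
of `K⁺` ramified in `K`, `E⁺_{K⁺}` the totally positive units of `K⁺`.  We prove, for a CM field `K` such that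
**every finite prime `v ≠ v₀` of `K⁺` is unramified in `K`** (this covers `t_K = 0` and `t_K = 1`):

1. (§1) **every unit of `K⁺` is a local norm at every unramified finite prime** — the Hilbert symbol
   `(θ, ε)_v = 1` for `K = K⁺(√θ)` — by the tree's `HilbertSymbolAtUnramifiedPlace.lean` (O'Meara 63:16 at
   every unramified place, dyadic places included): `IsCMField.hilbertSymbol_unit_eq_one_of_isUnramifiedIn`;
2. (§2) **every totally positive unit is a local norm everywhere** («a norm residue modulo the conductor»): at
   the real places because it is positive and `θ` is totally negative
   (`IsCMField.hilbertSymbol_completion_eq_one_iff_pos`), at the finite `v ≠ v₀` by §1, and at `v₀` by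
   **Hilbert's reciprocity law** (the tree's `hilbertReciprocity_holds`: the number of places with symbol `-1`
   is even, and it is at most one) — `IsCMField.forall_hilbertSymbol_unit_eq_one_of_totallyPositive`;
3. (§3) hence, by the **Hasse norm theorem** for `K/K⁺` (the tree's
   `IsCMField.exists_eq_mul_complexConj_of_forall_hilbertSymbol_eq_one`), **`ε = e · ē` for some `e ∈ K`**:
   `IsCMField.exists_unit_eq_mul_complexConj_of_totallyPositive` (and the `t_K = 0` form
   `IsCMField.exists_unit_eq_mul_complexConj_of_totallyPositive_of_forall_isUnramifiedIn`).

The index consequence («`E⁺_{K⁺} = N_{K/K⁺}(K^×) ∩ E_{K⁺}`», so Okazaki's `Q̃_K = [E⁺_{K⁺} : E²_{K⁺}]`, and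
Horie's Lemma 1 (ii) `r(A_K) = t_K − 1 + [K⁺ : ℚ] − r(E_{K⁺}/E⁺_{K⁺})` for `h(K⁺)` odd) is the business of
`CMFieldAmbiguousClassNumber.lean` (Chevalley's formula for `K/K⁺`), which consumes §3.

## References

* K. Horie, *On CM-fields with the same maximal real subfield*, Acta Arith. 67 (1994) 219–227, §1 Lemma 1 and
  its proof (held `paper:doi-10-4064-aa-67-3-219-227`, p. 220). [Horie1994]
* O. T. O'Meara, *Introduction to quadratic forms* (1963), §63C Example 63:16, §65D Thm. 65:23, §71 Thm. 71:18.
  [Omeara1963]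
-/

noncomputable section

open NumberField NumberField.InfinitePlace IsDedekindDomain

namespace Literature.NumberTheory.NumberFields

open Literature.NumberTheory.QuadraticForms

variable {L : Type} [Field L] [NumberField L] [IsCMField L]

/-! ### §1. Units are local norms at the unramified finite primes -/

omit [NumberField L] [IsCMField L] in
/-- A unit of `𝓞 L⁺` lies in no finite prime. [folklore] -/
private theorem unit_notMem (ε : (𝓞 (maximalRealSubfield L))ˣ)
    (v : HeightOneSpectrum (𝓞 (maximalRealSubfield L))) : (ε : 𝓞 (maximalRealSubfield L)) ∉ v.asIdeal :=
  fun h => v.isPrime.ne_top (Ideal.eq_top_of_isUnit_mem _ h ε.isUnit)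

/-- **A unit of `K⁺` is a local norm from `K = K⁺(√θ)` at every finite prime of `K⁺` unramified in `K`**:
`(θ, ε)_v = 1` (O'Meara 63:16 at every unramified place, dyadic places included —
`hilbertSymbol_eq_one_of_notMem_of_isUnramifiedIn`). [cite: Horie1994, §1 Lemma 1 (proof)]
[cite: Omeara1963, §63C Example 63:16] -/
theorem IsCMField.hilbertSymbol_unit_eq_one_of_isUnramifiedIn {α : L} (hα : IsCMField.complexConj L α = -α)
    (hα0 : α ≠ 0) {θ : maximalRealSubfield L} (hθ : α ^ 2 = algebraMap (maximalRealSubfield L) L θ)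
    {v : HeightOneSpectrum (𝓞 (maximalRealSubfield L))} (hunr : Algebra.IsUnramifiedIn (𝓞 L) v.asIdeal)
    (ε : (𝓞 (maximalRealSubfield L))ˣ) :
    hilbertSymbol (v.adicCompletion (maximalRealSubfield L))
        (algebraMap (maximalRealSubfield L) _ (θ : maximalRealSubfield L))
        (algebraMap (maximalRealSubfield L) _ ((ε : 𝓞 (maximalRealSubfield L)) : maximalRealSubfield L)) = 1 := by
  rw [hilbertSymbol_comm]
  exact hilbertSymbol_eq_one_of_notMem_of_isUnramifiedIn (maximalRealSubfield L) v hθ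
    (algebraMap_ne_of_complexConj_eq_neg hα hα0) hunr (unit_notMem ε v)

/-! ### §2. Totally positive units are local norms everywhere when at most one finite prime ramifies -/

/-- **«Every element of `E⁺_{K⁺}` is a norm residue for `K/K⁺`»** when every finite prime `v ≠ v₀` of `K⁺` is
unramified in `K`: for a totally positive unit `ε` of `K⁺` and `K = K⁺(√θ)` (`θ = α²`, `ᾱ = -α ≠ 0`), the Hilbert
symbol `(θ, ε)_v = 1` at EVERY finite prime `v` — at `v ≠ v₀` by §1, at the real places by positivity, and then
at `v₀` by Hilbert's reciprocity law («the product formula for the Hasse norm residue symbol»).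
[cite: Horie1994, §1 Lemma 1 (proof)] [cite: Omeara1963, §71 Thm. 71:18] -/
theorem IsCMField.forall_hilbertSymbol_unit_eq_one_of_totallyPositive {α : L}
    (hα : IsCMField.complexConj L α = -α) (hα0 : α ≠ 0) {θ : maximalRealSubfield L}
    (hθ : α ^ 2 = algebraMap (maximalRealSubfield L) L θ)
    {v₀ : HeightOneSpectrum (𝓞 (maximalRealSubfield L))}
    (hunr : ∀ v : HeightOneSpectrum (𝓞 (maximalRealSubfield L)), v ≠ v₀ → Algebra.IsUnramifiedIn (𝓞 L) v.asIdeal)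
    (ε : (𝓞 (maximalRealSubfield L))ˣ)
    (hpos : ∀ w : InfinitePlace (maximalRealSubfield L),
      0 < embedding_of_isReal (IsTotallyReal.isReal w) ((ε : 𝓞 (maximalRealSubfield L)) : maximalRealSubfield L))
    (v : HeightOneSpectrum (𝓞 (maximalRealSubfield L))) :
    hilbertSymbol (v.adicCompletion (maximalRealSubfield L))
        (algebraMap (maximalRealSubfield L) _ (θ : maximalRealSubfield L))
        (algebraMap (maximalRealSubfield L) _ ((ε : 𝓞 (maximalRealSubfield L)) : maximalRealSubfield L)) = 1 := by
  set b : maximalRealSubfield L := ((ε : 𝓞 (maximalRealSubfield L)) : maximalRealSubfield L) with hb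
  have hb0 : b ≠ 0 := by
    rw [hb]
    exact_mod_cast ε.ne_zero
  have hθ0 : (θ : maximalRealSubfield L) ≠ 0 := fun h0 => by
    rw [h0, map_zero, sq_eq_zero_iff] at hθ
    exact hα0 hθ
  -- symbols at the real places: `1`
  have hinf : ∀ w : InfinitePlace (maximalRealSubfield L),
      hilbertSymbol w.Completion (algebraMap (maximalRealSubfield L) _ (θ : maximalRealSubfield L))
        (algebraMap (maximalRealSubfield L) _ b) = 1 := fun w =>
    (IsCMField.hilbertSymbol_completion_eq_one_iff_pos hα hα0 hθ w b).2 (hpos w)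
  -- Hilbert reciprocity: the finite places with symbol `-1` are finite in number, of even total count
  obtain ⟨hSfin, heven⟩ := hilbertReciprocity_holds (maximalRealSubfield L) (θ : maximalRealSubfield L) b hθ0 hb0
  set S := {v : HeightOneSpectrum (𝓞 (maximalRealSubfield L)) |
      hilbertSymbol (v.adicCompletion (maximalRealSubfield L))
        (algebraMap (maximalRealSubfield L) _ (θ : maximalRealSubfield L))
        (algebraMap (maximalRealSubfield L) _ b) = -1} with hS
  have hinf0 : {w : InfinitePlace (maximalRealSubfield L) |
      hilbertSymbol w.Completion (algebraMap (maximalRealSubfield L) _ (θ : maximalRealSubfield L))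
        (algebraMap (maximalRealSubfield L) _ b) = -1} = ∅ := by
    ext w
    simp only [Set.mem_setOf_eq, Set.mem_empty_iff_false, iff_false, hinf w]
    norm_num
  rw [hinf0, Set.ncard_empty, add_zero] at heven
  -- `S ⊆ {v₀}`: every other finite prime is unramified
  have hSsub : S ⊆ {v₀} := fun u hu => by
    rw [Set.mem_singleton_iff]
    by_contra hne
    have h1 := IsCMField.hilbertSymbol_unit_eq_one_of_isUnramifiedIn hα hα0 hθ (hunr u hne) ε
    have h2 : hilbertSymbol (u.adicCompletion (maximalRealSubfield L))
        (algebraMap (maximalRealSubfield L) _ (θ : maximalRealSubfield L))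
        (algebraMap (maximalRealSubfield L) _ b) = -1 := hu
    rw [h1] at h2
    norm_num at h2
  have hcard : S.ncard ≤ 1 :=
    (Set.ncard_le_ncard hSsub (Set.finite_singleton _)).trans (by rw [Set.ncard_singleton])
  have hS0 : S.ncard = 0 := by
    obtain ⟨k, hk⟩ := heven
    omega
  have hSempty : S = ∅ := (Set.ncard_eq_zero hSfin).1 hS0
  -- so the symbol at `v` is not `-1`
  refine (hilbertSymbol_ne_neg_one_iff _ _).1 fun hv => ?_
  have hmem : v ∈ S := hv
  rw [hSempty] at hmem
  exact hmem

/-! ### §3. The Hasse norm theorem: totally positive units are global norms -/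

/-- **Horie, proof of Lemma 1 (ii): `E⁺_{K⁺} ⊆ N_{K/K⁺}(K^×)` when at most one finite prime of `K⁺` ramifies
in `K`** — if every finite prime `v ≠ v₀` of `K⁺` is unramified in the CM field `K`, every totally positive unit
`ε` of `K⁺` is a norm from `K`: `ε = e · ē` for some `e ∈ K` (a local norm everywhere by §2, then Hasse's norm
theorem for the quadratic extension `K/K⁺`). [cite: Horie1994, §1 Lemma 1 (ii) (proof)]
[cite: Omeara1963, §65D Thm. 65:23] -/
theorem IsCMField.exists_unit_eq_mul_complexConj_of_totallyPositive
    {v₀ : HeightOneSpectrum (𝓞 (maximalRealSubfield L))}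
    (hunr : ∀ v : HeightOneSpectrum (𝓞 (maximalRealSubfield L)), v ≠ v₀ → Algebra.IsUnramifiedIn (𝓞 L) v.asIdeal)
    (ε : (𝓞 (maximalRealSubfield L))ˣ)
    (hpos : ∀ w : InfinitePlace (maximalRealSubfield L),
      0 < embedding_of_isReal (IsTotallyReal.isReal w) ((ε : 𝓞 (maximalRealSubfield L)) : maximalRealSubfield L)) :
    ∃ e : L, algebraMap (maximalRealSubfield L) L ((ε : 𝓞 (maximalRealSubfield L)) : maximalRealSubfield L) =
      e * IsCMField.complexConj L e := by
  -- a generator `α` with `ᾱ = -α ≠ 0`, `α² = θ ∈ K⁺`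
  obtain ⟨x, hx⟩ := IsCMField.exists_complexConj_ne L
  set α : L := x - IsCMField.complexConj L x with hαdef
  have hα : IsCMField.complexConj L α = -α := by
    rw [hαdef, map_sub, IsCMField.complexConj_apply_apply, neg_sub]
  have hα0 : α ≠ 0 := fun h0 => hx (sub_eq_zero.1 h0).symm
  set θ : maximalRealSubfield L := ⟨α ^ 2, sq_mem_maximalRealSubfield_of_complexConj_eq_neg hα⟩ with hθdef
  have hθ : α ^ 2 = algebraMap (maximalRealSubfield L) L θ := rfl
  have hb0 : ((ε : 𝓞 (maximalRealSubfield L)) : maximalRealSubfield L) ≠ 0 := by exact_mod_cast ε.ne_zero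
  exact IsCMField.exists_eq_mul_complexConj_of_forall_hilbertSymbol_eq_one hα hα0 hθ hb0
    (IsCMField.forall_hilbertSymbol_unit_eq_one_of_totallyPositive hα hα0 hθ hunr ε hpos)
    (fun w => (IsCMField.hilbertSymbol_completion_eq_one_iff_pos hα hα0 hθ w _).2 (hpos w))

/-- **The case `t_K = 0`: if `K/K⁺` is unramified at every finite prime, every totally positive unit of `K⁺`
is a norm from `K`**, `ε = e · ē` («In the case `t_K = 0`, the assertion (ii) is an immediate consequence of
(1.1) and the Hasse norm theorem»). [cite: Horie1994, §1 Lemma 1 (ii) (proof)] [cite: Omeara1963, §65D Thm. 65:23] -/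
theorem IsCMField.exists_unit_eq_mul_complexConj_of_totallyPositive_of_forall_isUnramifiedIn
    (hunr : ∀ v : HeightOneSpectrum (𝓞 (maximalRealSubfield L)), Algebra.IsUnramifiedIn (𝓞 L) v.asIdeal)
    (ε : (𝓞 (maximalRealSubfield L))ˣ)
    (hpos : ∀ w : InfinitePlace (maximalRealSubfield L),
      0 < embedding_of_isReal (IsTotallyReal.isReal w) ((ε : 𝓞 (maximalRealSubfield L)) : maximalRealSubfield L)) :
    ∃ e : L, algebraMap (maximalRealSubfield L) L ((ε : 𝓞 (maximalRealSubfield L)) : maximalRealSubfield L) =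
      e * IsCMField.complexConj L e := by
  obtain ⟨p, hpbot, hp⟩ :=
    Ring.not_isField_iff_exists_prime.1 (RingOfIntegers.not_isField (maximalRealSubfield L))
  exact IsCMField.exists_unit_eq_mul_complexConj_of_totallyPositive (v₀ := ⟨p, hp, hpbot⟩)
    (fun v _ => hunr v) ε hpos

/-- The same with «totally positive» in the elementary form `∀ φ : K⁺ →+* ℝ, 0 < φ ε`.
[cite: Horie1994, §1 Lemma 1 (ii) (proof)] -/
theorem IsCMField.exists_unit_eq_mul_complexConj_of_forall_ringHom_pos
    {v₀ : HeightOneSpectrum (𝓞 (maximalRealSubfield L))}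
    (hunr : ∀ v : HeightOneSpectrum (𝓞 (maximalRealSubfield L)), v ≠ v₀ → Algebra.IsUnramifiedIn (𝓞 L) v.asIdeal)
    (ε : (𝓞 (maximalRealSubfield L))ˣ)
    (hpos : ∀ φ : maximalRealSubfield L →+* ℝ, 0 < φ ((ε : 𝓞 (maximalRealSubfield L)) : maximalRealSubfield L)) :
    ∃ e : L, algebraMap (maximalRealSubfield L) L ((ε : 𝓞 (maximalRealSubfield L)) : maximalRealSubfield L) =
      e * IsCMField.complexConj L e :=
  IsCMField.exists_unit_eq_mul_complexConj_of_totallyPositive hunr ε (fun _ => hpos _)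

end Literature.NumberTheory.NumberFields

end
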